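import Mathlib
import Literature.NumberTheory.LFunctions.Zhang2022.SkeletonMeanValue
import Literature.NumberTheory.LFunctions.Zhang2022.Section7MeanSquareMajorant
import HarnessLib

/-!
# Zhang (2022) §§7–8: a multiplicative majorant for `ξ₀ⱼ(n;d,r)` — the Euler-product tools

Topic `Literature/NumberTheory/LFunctions/Zhang2022` (Landau–Siegel audit tree; verdict-neutral).
Y. Zhang, *Discrete mean estimates and the Landau–Siegel zero*, arXiv:2211.02515v1 (2022)
[Zhang2022LandauSiegel], §7 p. 33 (the objects `𝔫(d)`, `κ`, `κ̃(d;m,s)`, `λ(m,s)`, `λ₀ⱼ`, `κ̃₀ⱼ`,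
`λ̃₀ⱼ`, `ξ₀ⱼ(n;d,r)`), §8 p. 47 ("Gathering these results together we conclude, by simple
approximation, that …", tex L2436) — **an unrefereed manuscript under adjudication** (campaign
D-0069). This file supplies the elementary multiplicative-function tools for the in-cone estimate
`XiZeroTailMean` wanted by GAP-LEDGER row `G-d20-1` (the absolute logarithmic mean
`Σ_{n<x}|ξ₀ⱼ(n;d,r)|/n ≪ (1+log x)³`, uniformly in `d, r`), proved in the companion file
`Section8XiZeroTailMean`:

* `sum_div_le_gen` — the tree's Euler-product majorant `MeanSquareMajorant.sum_div_le`
  (Hall–Tenenbaum (0.4) + Mertens) with the two extra freedoms needed here: a `1/p`-sized term at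
  the primes (`f(p) ≤ a + K log p + M/p`) and a constant in front of the prime-power bound
  (`f(p^ν) ≤ C₅(ν+1)^d`): `Σ_{n≤X} f(n)/n ≤ exp(4a + K log 4X + M + C₅S_d)·(log X)^a`;
* `locK`, `Kmaj` — the local factors `Σ_a ‖κ(q^{v+a})‖q^{−a}` and their product over `q^v ∥ m`,
  a multiplicative function of `m`, with `locK q v ≤ ‖κ(q^v)‖ + (v+1)³·S₃/q`;
* `norm_kappaTilde_le_Kmaj` — **`‖κ̃(d;m,s)‖ ≤ Kmaj(d)` for `Re s = 1`** (every finite partial sum of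
  the defining series over `𝔫(d)` lies in an exponent box, where `κ` factors over the primes of `d`).

No statement about the manuscript's Theorems 1–2 or about Landau–Siegel zeros is made or implied.

## References

* Y. Zhang, arXiv:2211.02515v1 (2022), §7 p. 33, §8 p. 47. [cite: Zhang2022LandauSiegel, §7 p.33; §8 p.47]
* R. R. Hall, G. Tenenbaum, *Divisors* (CUP 1988), (0.4). [cite: HallTenenbaum1988, (0.4)]
-/

noncomputable section

open Finset Real ArithmeticFunction

namespace Literature.NumberTheory.LFunctions.Zhang2022.XiZeroMajorant

open MeanSquareMajorant

/-! ### Part 1. The Euler-product majorant with a `1/p` term and a prime-power constant -/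

variable {f : ℕ → ℝ}

/-- **The Euler-product majorant, general form.** Let `f ≥ 0` be multiplicative with summable
local series `Σ_ν f(p^ν)p^{−ν}` at every prime, and with `f(p) ≤ a + K log p + M/p` (`a : ℕ`,
`K, M ≥ 0`) and `f(p^ν) ≤ C₅(ν+1)^d` (`C₅ ≥ 0`) at the primes `p ≤ X`. Then for `X ≥ 2`,
`Σ_{n≤X} f(n)/n ≤ exp(4a + K log(4X) + M + C₅ S_d)·(log X)^a` (`S_d = LogEulerProduct.tailConst d`).
Same proof as the tree's `MeanSquareMajorant.sum_div_le` (Hall–Tenenbaum (0.4), local factors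
`≤ exp(f(p)/p + C₅S_d/p²)`, Mertens), with `Σ_p (M/p)/p ≤ M·Σ 1/(p(p−1)) ≤ M`.
[cite: HallTenenbaum1988, (0.4)] -/
theorem sum_div_le_gen (hf1 : f 1 = 1) (hmul : ∀ m n, Nat.Coprime m n → f (m * n) = f m * f n)
    (hf0 : ∀ n, 0 ≤ f n) {a d : ℕ} {K M C₅ : ℝ} (hK : 0 ≤ K) (hM : 0 ≤ M) (hC₅ : 0 ≤ C₅)
    {X : ℕ} (hX : 2 ≤ X)
    (hsum : ∀ p, p.Prime → Summable (fun ν : ℕ => f (p ^ ν) / (p : ℝ) ^ ν))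
    (hfp : ∀ p, p.Prime → p ≤ X → f p ≤ a + K * Real.log p + M / p)
    (hfpow : ∀ p ν : ℕ, p.Prime → p ≤ X → f (p ^ ν) ≤ C₅ * ((ν : ℝ) + 1) ^ d) :
    ∑ n ∈ Icc 1 X, f n / n ≤
      Real.exp (4 * a + K * Real.log (4 * X) + M + C₅ * LogEulerProduct.tailConst d) *
        Real.log X ^ a := by
  -- the tail `ν ≥ 2`: termwise `f(p^{i+2})/p^{i+2} ≤ C₅ (i+3)^d 2^{-i} / p²` (`p ≤ X`)
  have hterm2 : ∀ p i : ℕ, p.Prime → p ≤ X →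
      f (p ^ (i + 2)) / (p : ℝ) ^ (i + 2) ≤
        C₅ * (((i : ℝ) + 3) ^ d * (1 / 2 : ℝ) ^ i) / (p : ℝ) ^ 2 := by
    intro p i hp hpX
    have hp2 : (2 : ℝ) ≤ p := by exact_mod_cast hp.two_le
    rw [div_le_div_iff₀ (by positivity) (by positivity)]
    have h1 : f (p ^ (i + 2)) ≤ C₅ * ((i : ℝ) + 3) ^ d := by
      have h := hfpow p (i + 2) hp hpX
      have e : ((↑(i + 2) : ℝ) + 1) = (i : ℝ) + 3 := by push_cast; ring
      rwa [e] at h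
    have h2 : (p : ℝ) ^ 2 ≤ (1 / 2 : ℝ) ^ i * (p : ℝ) ^ (i + 2) := by
      rw [pow_add, ← mul_assoc, ← mul_pow]
      exact le_mul_of_one_le_left (by positivity) (one_le_pow₀ (by linarith))
    calc f (p ^ (i + 2)) * (p : ℝ) ^ 2 ≤ C₅ * ((i : ℝ) + 3) ^ d * (p : ℝ) ^ 2 :=
          mul_le_mul_of_nonneg_right h1 (by positivity)
      _ ≤ C₅ * ((i : ℝ) + 3) ^ d * ((1 / 2 : ℝ) ^ i * (p : ℝ) ^ (i + 2)) :=
          mul_le_mul_of_nonneg_left h2 (by positivity)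
      _ = C₅ * (((i : ℝ) + 3) ^ d * (1 / 2 : ℝ) ^ i) * (p : ℝ) ^ (i + 2) := by ring
  have htail : ∀ p, p.Prime → p ≤ X →
      ∑' i : ℕ, f (p ^ (i + 2)) / (p : ℝ) ^ (i + 2) ≤
        C₅ * LogEulerProduct.tailConst d / (p : ℝ) ^ 2 := by
    intro p hp hpX
    have hs1 := (summable_nat_add_iff (f := fun ν : ℕ => f (p ^ ν) / (p : ℝ) ^ ν) 2).mpr
      (hsum p hp)
    have hs2 : Summable (fun i : ℕ => C₅ * (((i : ℝ) + 3) ^ d * (1 / 2 : ℝ) ^ i) / (p : ℝ) ^ 2) :=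
      ((LogEulerProduct.summable_tailConst d).mul_left C₅).div_const _
    calc ∑' i : ℕ, f (p ^ (i + 2)) / (p : ℝ) ^ (i + 2)
        ≤ ∑' i : ℕ, C₅ * (((i : ℝ) + 3) ^ d * (1 / 2 : ℝ) ^ i) / (p : ℝ) ^ 2 :=
          Summable.tsum_le_tsum (fun i => hterm2 p i hp hpX) hs1 hs2
      _ = C₅ * LogEulerProduct.tailConst d / (p : ℝ) ^ 2 := by
          rw [tsum_div_const, tsum_mul_left]; rfl
  -- each local factor: `Σ_ν f(p^ν)/p^ν = 1 + f(p)/p + T_p ≤ exp(f(p)/p + C₅S_d/p²)`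
  have hloc : ∀ p, p.Prime → p ≤ X →
      ∑' ν : ℕ, f (p ^ ν) / (p : ℝ) ^ ν ≤
        Real.exp (f p / p + C₅ * LogEulerProduct.tailConst d / (p : ℝ) ^ 2) := by
    intro p hp hpX
    have hsplit := (hsum p hp).sum_add_tsum_nat_add 2
    have h2 : ∑ i ∈ range 2, f (p ^ i) / (p : ℝ) ^ i = 1 + f p / p := by
      simp [Finset.sum_range_succ, hf1]
    rw [← hsplit, h2]
    have ht := htail p hp hpX
    calc 1 + f p / p + ∑' i : ℕ, f (p ^ (i + 2)) / (p : ℝ) ^ (i + 2)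
        ≤ (f p / p + C₅ * LogEulerProduct.tailConst d / (p : ℝ) ^ 2) + 1 := by linarith
      _ ≤ _ := Real.add_one_le_exp _
  have hprod : ∏ p ∈ Nat.primesLE X, ∑' ν : ℕ, f (p ^ ν) / (p : ℝ) ^ ν ≤
      Real.exp (∑ p ∈ Nat.primesLE X,
        (f p / p + C₅ * LogEulerProduct.tailConst d / (p : ℝ) ^ 2)) := by
    rw [Real.exp_sum]
    exact prod_le_prod (fun p _ => tsum_nonneg fun ν => div_nonneg (hf0 _) (by positivity))
      fun p hp => hloc p (Nat.mem_primesLE.1 hp).2 (Nat.mem_primesLE.1 hp).1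
  -- `Σ_{p≤X} 1/p² ≤ Σ 1/(p(p−1)) ≤ 1`
  have hp2sum : ∑ p ∈ Nat.primesLE X, (1 : ℝ) / (p : ℝ) ^ 2 ≤ 1 := by
    calc ∑ p ∈ Nat.primesLE X, (1 : ℝ) / (p : ℝ) ^ 2
        ≤ ∑ p ∈ Nat.primesLE X, (1 : ℝ) / (p * (p - 1)) := by
          refine sum_le_sum fun p hp => ?_
          have hp2 : (2 : ℝ) ≤ p := by exact_mod_cast (Nat.mem_primesLE.1 hp).2.two_le
          exact one_div_le_one_div_of_le (by nlinarith) (by nlinarith)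
      _ ≤ 1 := MertensBound.sum_inv_prime_mul_pred_le_one X
  have htailsum :
      ∑ p ∈ Nat.primesLE X, C₅ * LogEulerProduct.tailConst d / (p : ℝ) ^ 2 ≤
        C₅ * LogEulerProduct.tailConst d := by
    have hS : 0 ≤ C₅ * LogEulerProduct.tailConst d :=
      mul_nonneg hC₅ (LogEulerProduct.tailConst_nonneg d)
    calc ∑ p ∈ Nat.primesLE X, C₅ * LogEulerProduct.tailConst d / (p : ℝ) ^ 2
        = C₅ * LogEulerProduct.tailConst d * ∑ p ∈ Nat.primesLE X, 1 / (p : ℝ) ^ 2 := by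
          rw [mul_sum]; exact sum_congr rfl fun p _ => by ring
      _ ≤ C₅ * LogEulerProduct.tailConst d * 1 := mul_le_mul_of_nonneg_left hp2sum hS
      _ = _ := mul_one _
  -- the prime sum with the `M/p` term
  have hprime : ∑ p ∈ Nat.primesLE X, f p / p ≤
      a * (Real.log (Real.log X) + 4) + K * (Real.log X + Real.log 4) + M := by
    have h1 : ∀ p ∈ Nat.primesLE X,
        f p / p ≤ a * (1 / p) + K * (Real.log p / p) + M * (1 / (p : ℝ) ^ 2) := by
      intro p hp
      have hp' := (Nat.mem_primesLE.1 hp).2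
      have hp0 : (0 : ℝ) < p := by exact_mod_cast hp'.pos
      rw [div_le_iff₀ hp0]
      calc f p ≤ a + K * Real.log p + M / p := hfp p hp' (Nat.mem_primesLE.1 hp).1
        _ = (a * (1 / p) + K * (Real.log p / p) + M * (1 / (p : ℝ) ^ 2)) * p := by
            field_simp
    calc ∑ p ∈ Nat.primesLE X, f p / p
        ≤ ∑ p ∈ Nat.primesLE X, (a * (1 / p) + K * (Real.log p / p) + M * (1 / (p : ℝ) ^ 2)) :=
          sum_le_sum h1
      _ = a * ∑ p ∈ Nat.primesLE X, (1 : ℝ) / p + K * ∑ p ∈ Nat.primesLE X, Real.log p / p +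
            M * ∑ p ∈ Nat.primesLE X, (1 : ℝ) / (p : ℝ) ^ 2 := by
          rw [sum_add_distrib, sum_add_distrib, mul_sum, mul_sum, mul_sum]
      _ ≤ a * (Real.log (Real.log X) + 4) + K * (Real.log X + Real.log 4) + M * 1 := by
          gcongr
          · exact MertensBound.sum_inv_prime_le X hX
          · exact MertensBound.sum_log_div_prime_le X
      _ = _ := by rw [mul_one]
  have hexp : ∑ p ∈ Nat.primesLE X, (f p / p + C₅ * LogEulerProduct.tailConst d / (p : ℝ) ^ 2) ≤
      a * (Real.log (Real.log X) + 4) + K * (Real.log X + Real.log 4) + M +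
        C₅ * LogEulerProduct.tailConst d := by
    rw [sum_add_distrib]
    linarith [hprime, htailsum]
  -- assemble
  have hX1 : (1 : ℝ) < X := by exact_mod_cast hX
  have hX0 : (0 : ℝ) < X := by linarith
  have hlogX : 0 < Real.log X := Real.log_pos hX1
  calc ∑ n ∈ Icc 1 X, f n / n
      ≤ ∏ p ∈ Nat.primesLE X, ∑' ν : ℕ, f (p ^ ν) / (p : ℝ) ^ ν :=
        HallTenenbaum.sum_div_le_prod_tsum hf1 hmul hf0 hsum X
    _ ≤ Real.exp (∑ p ∈ Nat.primesLE X,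
          (f p / p + C₅ * LogEulerProduct.tailConst d / (p : ℝ) ^ 2)) := hprod
    _ ≤ Real.exp (a * (Real.log (Real.log X) + 4) + K * (Real.log X + Real.log 4) + M +
          C₅ * LogEulerProduct.tailConst d) := Real.exp_le_exp.2 hexp
    _ = Real.exp (4 * a + K * Real.log (4 * X) + M + C₅ * LogEulerProduct.tailConst d) *
          Real.log X ^ a := by
        have e1 : Real.log (4 * X) = Real.log X + Real.log 4 := by
          rw [Real.log_mul (by norm_num) hX0.ne', add_comm]
        have e2 : Real.log X ^ a = Real.exp (a * Real.log (Real.log X)) := by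
          rw [← Real.log_pow, Real.exp_log (pow_pos hlogX a)]
        rw [e1, e2, ← Real.exp_add]
        congr 1; ring

/-! ### Part 2. The local factors of `κ` and the majorant `Kmaj` of `κ̃` -/

variable (c' : ℝ) (D : ℕ)

/-- The local factor at `q^v`: `locK q v = Σ_{a≥0} ‖κ(q^{v+a})‖ q^{−a}` (`κ = Skeleton.kappaZ c′ D`).
[cite: Zhang2022LandauSiegel, §7 p.33] -/
def locK (q v : ℕ) : ℝ := ∑' a : ℕ, ‖Skeleton.kappaZ c' D (q ^ (v + a))‖ / (q : ℝ) ^ a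

/-- The multiplicative majorant `Kmaj m = ∏_{q^v ∥ m} locK q v` of `κ̃(m;·,s)` (`Re s = 1`).
[cite: Zhang2022LandauSiegel, §7 p.33] -/
def Kmaj (m : ℕ) : ℝ := m.factorization.prod fun q v => locK c' D q v

/-- Termwise bound of the local series: `‖κ(q^{v+a})‖/q^a ≤ (v+1)³(a+1)³ 2^{−a}` for a prime `q`.
[cite: Zhang2022LandauSiegel, §7 p.33] -/
theorem locK_term_le {q : ℕ} (hq : q.Prime) (v a : ℕ) :
    ‖Skeleton.kappaZ c' D (q ^ (v + a))‖ / (q : ℝ) ^ a ≤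
      ((v : ℝ) + 1) ^ 3 * (((a : ℝ) + 1) ^ 3 * (1 / 2 : ℝ) ^ a) := by
  have hq2 : (2 : ℝ) ≤ q := by exact_mod_cast hq.two_le
  have hqpos : (0 : ℝ) < (q : ℝ) ^ a := by positivity
  rw [div_le_iff₀ hqpos]
  have h1 : (1 : ℝ) ≤ (1 / 2 : ℝ) ^ a * (q : ℝ) ^ a := by
    rw [← mul_pow]; exact one_le_pow₀ (by linarith)
  have hk : ‖Skeleton.kappaZ c' D (q ^ (v + a))‖ ≤ ((v : ℝ) + 1) ^ 3 * ((a : ℝ) + 1) ^ 3 := by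
    refine (norm_kappa_prime_pow_le _ _ _ hq (v + a)).trans ?_
    rw [← mul_pow]
    apply pow_le_pow_left₀ (by positivity)
    push_cast; nlinarith
  calc ‖Skeleton.kappaZ c' D (q ^ (v + a))‖ ≤ ((v : ℝ) + 1) ^ 3 * ((a : ℝ) + 1) ^ 3 := hk
    _ ≤ ((v : ℝ) + 1) ^ 3 * ((a : ℝ) + 1) ^ 3 * ((1 / 2 : ℝ) ^ a * (q : ℝ) ^ a) :=
        le_mul_of_one_le_right (by positivity) h1
    _ = _ := by ring

/-- The local series converges (by comparison with `(v+1)³(a+1)³2^{−a}`).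
[cite: Zhang2022LandauSiegel, §7 p.33] -/
theorem summable_locK {q : ℕ} (hq : q.Prime) (v : ℕ) :
    Summable fun a : ℕ => ‖Skeleton.kappaZ c' D (q ^ (v + a))‖ / (q : ℝ) ^ a := by
  refine Summable.of_nonneg_of_le (fun a => div_nonneg (norm_nonneg _) (by positivity))
    (fun a => (locK_term_le c' D hq v a).trans ?_)
    (((LogEulerProduct.summable_tailConst 3).mul_left (((v : ℝ) + 1) ^ 3)))
  refine mul_le_mul_of_nonneg_left (mul_le_mul_of_nonneg_right
    (pow_le_pow_left₀ (by positivity) (by linarith) 3) (by positivity)) (by positivity)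

/-- `0 ≤ locK q v`. [cite: Zhang2022LandauSiegel, §7 p.33] -/
theorem locK_nonneg (q v : ℕ) : 0 ≤ locK c' D q v :=
  tsum_nonneg fun a => div_nonneg (norm_nonneg _) (by positivity)

/-- **The local factor is `‖κ(q^v)‖` plus a `1/q`-sized tail**:
`locK q v ≤ ‖κ(q^v)‖ + (v+1)³·S₃/q`, `S₃ = LogEulerProduct.tailConst 3` (`q` prime).
[cite: Zhang2022LandauSiegel, §7 p.33] -/
theorem locK_le {q : ℕ} (hq : q.Prime) (v : ℕ) :
    locK c' D q v ≤ ‖Skeleton.kappaZ c' D (q ^ v)‖ +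
      ((v : ℝ) + 1) ^ 3 * LogEulerProduct.tailConst 3 / q := by
  have hq2 : (2 : ℝ) ≤ q := by exact_mod_cast hq.two_le
  have hq0 : (0 : ℝ) < q := by linarith
  have hs := summable_locK c' D hq v
  -- the tail `a ≥ 1`: `‖κ(q^{v+1+i})‖/q^{i+1} ≤ (v+1)³ (i+3)³ 2^{-i} / q`
  have hterm : ∀ i : ℕ, ‖Skeleton.kappaZ c' D (q ^ (v + (i + 1)))‖ / (q : ℝ) ^ (i + 1) ≤
      ((v : ℝ) + 1) ^ 3 * (((i : ℝ) + 3) ^ 3 * (1 / 2 : ℝ) ^ i) / q := by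
    intro i
    have hk : ‖Skeleton.kappaZ c' D (q ^ (v + (i + 1)))‖ ≤
        ((v : ℝ) + 1) ^ 3 * ((i : ℝ) + 3) ^ 3 := by
      refine (norm_kappa_prime_pow_le _ _ _ hq (v + (i + 1))).trans ?_
      rw [← mul_pow]
      apply pow_le_pow_left₀ (by positivity)
      push_cast; nlinarith
    have hhalf : (q : ℝ)⁻¹ ≤ 1 / 2 := by rw [one_div]; exact inv_anti₀ two_pos hq2
    have hqi : ((q : ℝ) ^ (i + 1))⁻¹ ≤ (1 / 2 : ℝ) ^ i / q := by
      rw [pow_succ, mul_inv, ← inv_pow, div_eq_mul_inv]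
      exact mul_le_mul_of_nonneg_right (pow_le_pow_left₀ (by positivity) hhalf i)
        (by positivity)
    calc ‖Skeleton.kappaZ c' D (q ^ (v + (i + 1)))‖ / (q : ℝ) ^ (i + 1)
        = ‖Skeleton.kappaZ c' D (q ^ (v + (i + 1)))‖ * ((q : ℝ) ^ (i + 1))⁻¹ := by
          rw [div_eq_mul_inv]
      _ ≤ (((v : ℝ) + 1) ^ 3 * ((i : ℝ) + 3) ^ 3) * ((1 / 2 : ℝ) ^ i / q) :=
          mul_le_mul hk hqi (by positivity) (by positivity)
      _ = _ := by ring
  have hs1 := (summable_nat_add_iff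
    (f := fun a : ℕ => ‖Skeleton.kappaZ c' D (q ^ (v + a))‖ / (q : ℝ) ^ a) 1).mpr hs
  have hs2 : Summable fun i : ℕ => ((v : ℝ) + 1) ^ 3 * (((i : ℝ) + 3) ^ 3 * (1 / 2 : ℝ) ^ i) / q :=
    (((LogEulerProduct.summable_tailConst 3).mul_left _)).div_const _
  have htailb : ∑' i : ℕ, ‖Skeleton.kappaZ c' D (q ^ (v + (i + 1)))‖ / (q : ℝ) ^ (i + 1) ≤
      ((v : ℝ) + 1) ^ 3 * LogEulerProduct.tailConst 3 / q := by
    calc ∑' i : ℕ, ‖Skeleton.kappaZ c' D (q ^ (v + (i + 1)))‖ / (q : ℝ) ^ (i + 1)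
        ≤ ∑' i : ℕ, ((v : ℝ) + 1) ^ 3 * (((i : ℝ) + 3) ^ 3 * (1 / 2 : ℝ) ^ i) / q :=
          Summable.tsum_le_tsum hterm hs1 hs2
      _ = ((v : ℝ) + 1) ^ 3 * LogEulerProduct.tailConst 3 / q := by
          rw [tsum_div_const, tsum_mul_left]; rfl
  rw [locK, ← hs.sum_add_tsum_nat_add 1, Finset.sum_range_one, pow_zero, add_zero, div_one]
  linarith [htailb]

/-- `0 ≤ Kmaj m`. [cite: Zhang2022LandauSiegel, §7 p.33] -/
theorem Kmaj_nonneg (m : ℕ) : 0 ≤ Kmaj c' D m := by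
  unfold Kmaj Finsupp.prod
  exact prod_nonneg fun q _ => locK_nonneg c' D q _

/-- `Kmaj 1 = 1`. [cite: Zhang2022LandauSiegel, §7 p.33] -/
theorem Kmaj_one : Kmaj c' D 1 = 1 := by
  simp [Kmaj]

/-- `Kmaj` is multiplicative on coprime arguments (disjoint factorizations).
[cite: Zhang2022LandauSiegel, §7 p.33] -/
theorem Kmaj_mul_of_coprime {m n : ℕ} (hmn : Nat.Coprime m n) :
    Kmaj c' D (m * n) = Kmaj c' D m * Kmaj c' D n := by
  rcases Nat.eq_zero_or_pos m with rfl | hm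
  · simp only [Nat.coprime_zero_left] at hmn; subst hmn; simp [Kmaj]
  rcases Nat.eq_zero_or_pos n with rfl | hn
  · simp only [Nat.coprime_zero_right] at hmn; subst hmn; simp [Kmaj]
  unfold Kmaj
  rw [Nat.factorization_mul hm.ne' hn.ne',
    Finsupp.prod_add_index_of_disjoint (Nat.Coprime.disjoint_primeFactors hmn |>.mono
      (by rw [Nat.support_factorization]) (by rw [Nat.support_factorization]))]

/-- At a prime power: `Kmaj (q^v) = locK q v` (`v ≥ 1`). [cite: Zhang2022LandauSiegel, §7 p.33] -/
theorem Kmaj_prime_pow {q : ℕ} (hq : q.Prime) {v : ℕ} (hv : v ≠ 0) :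
    Kmaj c' D (q ^ v) = locK c' D q v := by
  unfold Kmaj
  rw [hq.factorization_pow, Finsupp.prod, Finsupp.support_single _ hv, prod_singleton,
    Finsupp.single_eq_same]

/-! ### Part 3. The Euler box identity and `‖κ̃(d;m,s)‖ ≤ Kmaj d` -/

/-- **Euler product over `s`-factored numbers for exponent-local weights**: for non-negative
`φ q a` with `Σ_a φ q a < ∞` at the primes `q ∈ s`,
`Σ_{h ∈ factoredNumbers s} ∏_{q∈s} φ q (v_q(h)) = ∏_{q∈s} Σ_a φ q a`
(induction on `s` with Mathlib's `equivProdNatFactoredNumbers`). [cite: HallTenenbaum1988, (0.4)] -/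
theorem summable_hasSum_factoredNumbers_localProd {φ : ℕ → ℕ → ℝ} (hφ0 : ∀ q a, 0 ≤ φ q a)
    (hφs : ∀ q, q.Prime → Summable (φ q)) (s : Finset ℕ) (hs : ∀ q ∈ s, q.Prime) :
    Summable (fun h : Nat.factoredNumbers s => ∏ q ∈ s, φ q (h.val.factorization q)) ∧
      HasSum (fun h : Nat.factoredNumbers s => ∏ q ∈ s, φ q (h.val.factorization q))
        (∏ q ∈ s, ∑' a, φ q a) := by
  induction s using Finset.induction with
  | empty =>
    simp only [prod_empty]
    rw [Nat.factoredNumbers_empty]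
    refine ⟨(Set.finite_singleton 1).summable (fun _ : ℕ => (1 : ℝ)), ?_⟩
    have h := hasSum_singleton (1 : ℕ) (fun _ : ℕ => (1 : ℝ))
    exact h
  | insert p s hp ih =>
    have hpp : p.Prime := hs p (mem_insert_self p s)
    obtain ⟨ih1, ih2⟩ := ih fun q hq => hs q (mem_insert_of_mem hq)
    have hkey : ∀ x : ℕ × Nat.factoredNumbers s,
        (∏ q ∈ insert p s,
            φ q ((Nat.equivProdNatFactoredNumbers hpp hp x).val.factorization q)) =
          φ p x.1 * ∏ q ∈ s, φ q (x.2.val.factorization q) := by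
      rintro ⟨e, m, hm⟩
      rw [Nat.equivProdNatFactoredNumbers_apply', prod_insert hp]
      have hm0 : m ≠ 0 := (Nat.mem_factoredNumbers.mp hm).1
      have hpm : ¬ p ∣ m := fun hdvd =>
        hp ((Nat.mem_factoredNumbers.mp hm).2 p ((Nat.mem_primeFactorsList hm0).mpr ⟨hpp, hdvd⟩))
      have hfac : ∀ q, (p ^ e * m).factorization q = (Finsupp.single p e) q + m.factorization q := by
        intro q
        rw [Nat.factorization_mul (pow_ne_zero e hpp.ne_zero) hm0, Finsupp.add_apply,
          hpp.factorization_pow]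
      dsimp only
      congr 1
      · rw [hfac, Finsupp.single_eq_same, Nat.factorization_eq_zero_of_not_dvd hpm, add_zero]
      · refine prod_congr rfl fun q hq => ?_
        have hqp : q ≠ p := fun h => hp (h ▸ hq)
        rw [hfac, Finsupp.single_apply, if_neg (Ne.symm hqp), zero_add]
    have hprodnn : ∀ x : Nat.factoredNumbers s, 0 ≤ ∏ q ∈ s, φ q (x.val.factorization q) :=
      fun x => prod_nonneg fun q _ => hφ0 _ _
    have hcomp : (fun h : Nat.factoredNumbers (insert p s) =>
          ∏ q ∈ insert p s, φ q (h.val.factorization q)) ∘ (Nat.equivProdNatFactoredNumbers hpp hp) =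
        fun x => φ p x.1 * ∏ q ∈ s, φ q (x.2.val.factorization q) :=
      funext fun x => hkey x
    have hmul : Summable fun x : ℕ × Nat.factoredNumbers s =>
        φ p x.1 * ∏ q ∈ s, φ q (x.2.val.factorization q) := by
      apply Summable.mul_of_nonneg (hφs p hpp) ih1 <;> intro x
      · exact hφ0 _ _
      · exact hprodnn x
    constructor
    · rw [← (Nat.equivProdNatFactoredNumbers hpp hp).summable_iff, hcomp]
      exact hmul
    · rw [prod_insert hp, ← (Nat.equivProdNatFactoredNumbers hpp hp).hasSum_iff, hcomp]
      exact (hφs p hpp).hasSum.mul ih2 hmul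

/-- `𝔫(d)` is the set of `d.primeFactors`-factored numbers (`d ≠ 0`).
[cite: Zhang2022LandauSiegel, §7 p.33] -/
theorem nset_eq_factoredNumbers {d : ℕ} (hd : d ≠ 0) :
    Skeleton.nset d = Nat.factoredNumbers d.primeFactors := by
  ext h
  simp only [Skeleton.nset, Set.mem_setOf_eq, Nat.mem_factoredNumbers, Nat.mem_primeFactors]
  constructor
  · rintro ⟨hpos, hdiv⟩
    refine ⟨hpos.ne', fun p hp => ?_⟩
    have hp' := (Nat.mem_primeFactorsList hpos.ne').mp hp
    exact ⟨hp'.1, hdiv p hp'.1 hp'.2, hd⟩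
  · rintro ⟨hne, hmem⟩
    refine ⟨Nat.pos_of_ne_zero hne, fun q hq hqh => ?_⟩
    exact (hmem q ((Nat.mem_primeFactorsList hne).mpr ⟨hq, hqh⟩)).2.1

/-- For `h ∈ 𝔫(d)`: `‖κ(dh)‖/h = ∏_{q ∣ d} ‖κ(q^{v_q(d)+v_q(h)})‖ q^{−v_q(h)}` (`κ` multiplicative).
[cite: Zhang2022LandauSiegel, §7 p.33] -/
theorem norm_kappa_mul_div_eq_prod {d h : ℕ} (hd : d ≠ 0)
    (hh : h ∈ Nat.factoredNumbers d.primeFactors) :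
    ‖Skeleton.kappaZ c' D (d * h)‖ / h =
      ∏ q ∈ d.primeFactors, ‖Skeleton.kappaZ c' D (q ^ (d.factorization q + h.factorization q))‖ /
        (q : ℝ) ^ h.factorization q := by
  have hh0 : h ≠ 0 := (Nat.mem_factoredNumbers.mp hh).1
  have hsub : h.primeFactors ⊆ d.primeFactors := Nat.primeFactors_subset_of_mem_factoredNumbers hh
  have hκ := MeanSquareMajorant.isMultiplicative_kappa (Skeleton.b1 c' D) (Skeleton.b2 c' D)
    (Skeleton.b3 c' D)
  -- `‖κ(dh)‖ = ∏_{q ∣ d} ‖κ(q^{v_q(dh)})‖`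
  have h1 : ‖Skeleton.kappaZ c' D (d * h)‖ =
      ∏ q ∈ d.primeFactors, ‖Skeleton.kappaZ c' D (q ^ (d.factorization q + h.factorization q))‖ := by
    rw [Skeleton.kappaZ, hκ.multiplicative_factorization _ (mul_ne_zero hd hh0), Finsupp.prod,
      Nat.support_factorization, Nat.primeFactors_mul hd hh0, Finset.union_eq_left.mpr hsub,
      norm_prod]
    refine prod_congr rfl fun q _ => ?_
    rw [Nat.factorization_mul hd hh0, Finsupp.add_apply]
  -- `h = ∏_{q ∣ d} q^{v_q(h)}`
  have h2 : (h : ℝ) = ∏ q ∈ d.primeFactors, (q : ℝ) ^ h.factorization q := by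
    have hprod : ∏ q ∈ d.primeFactors, q ^ h.factorization q = h := by
      rw [← Finset.prod_subset hsub (fun q _ hq => by
        rw [Finsupp.notMem_support_iff.mp (by rwa [Nat.support_factorization]), pow_zero])]
      have := Nat.prod_factorization_pow_eq_self hh0
      rwa [Finsupp.prod, Nat.support_factorization] at this
    exact_mod_cast hprod.symm
  rw [h1, h2, ← prod_div_distrib]

/-- **`‖κ̃(d;m,s)‖ ≤ Kmaj d` for `Re s = 1`** (any `m`; the coprimality condition only removes
non-negative terms): the defining series of `κ̃` (`SkeletonMeanValue.kappaTilde`) is dominated by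
`Σ_{h∈𝔫(d)} ‖κ(dh)‖/h = ∏_{q^v ∥ d} Σ_a ‖κ(q^{v+a})‖q^{−a}`. [cite: Zhang2022LandauSiegel, §7 p.33] -/
theorem norm_kappaTilde_le_Kmaj {d : ℕ} (hd : d ≠ 0) (m : ℕ) {s : ℂ} (hs : s.re = 1) :
    ‖Skeleton.kappaTilde c' D d m s‖ ≤ Kmaj c' D d := by
  classical
  set P := d.primeFactors with hP
  have hPprime : ∀ q ∈ P, q.Prime := fun q hq => Nat.prime_of_mem_primeFactors hq
  -- the local weights
  set φ : ℕ → ℕ → ℝ := fun q a =>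
    ‖Skeleton.kappaZ c' D (q ^ (d.factorization q + a))‖ / (q : ℝ) ^ a with hφ
  have hφ0 : ∀ q a, 0 ≤ φ q a := fun q a => div_nonneg (norm_nonneg _) (by positivity)
  have hφs : ∀ q, q.Prime → Summable (φ q) := fun q hq => summable_locK c' D hq _
  obtain ⟨-, hHas⟩ := summable_hasSum_factoredNumbers_localProd hφ0 hφs P hPprime
  -- its sum is `Kmaj d`
  have hK : ∏ q ∈ P, ∑' a, φ q a = Kmaj c' D d := by
    rw [Kmaj, Finsupp.prod, Nat.support_factorization]
    rfl
  -- the majorant `G = 𝟙_{𝔫(d)} · ‖κ(dh)‖/h` has sum `Kmaj d`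
  set G : ℕ → ℝ := (Skeleton.nset d).indicator fun h => ‖Skeleton.kappaZ c' D (d * h)‖ / h
    with hG
  have hGsum : HasSum G (Kmaj c' D d) := by
    rw [hG, nset_eq_factoredNumbers hd, ← hasSum_subtype_iff_indicator, ← hK]
    convert hHas using 1
    funext x
    exact norm_kappa_mul_div_eq_prod c' D hd x.2
  -- termwise domination of the `κ̃`-series
  set F : ℕ → ℂ := fun h => if h ∈ Skeleton.nset d ∧ Nat.Coprime h m then
    Skeleton.kappaZ c' D (d * h) / (h : ℂ) ^ s else 0 with hF
  have hFG : ∀ h, ‖F h‖ ≤ G h := by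
    intro h
    by_cases hmem : h ∈ Skeleton.nset d
    · have hpos : 0 < h := hmem.1
      rw [hG, Set.indicator_of_mem hmem]
      by_cases hcop : Nat.Coprime h m
      · rw [hF]; dsimp only; rw [if_pos ⟨hmem, hcop⟩, norm_div,
          Complex.norm_natCast_cpow_of_pos hpos, hs, Real.rpow_one]
      · rw [hF]; dsimp only; rw [if_neg (fun h' => hcop h'.2), norm_zero]
        exact div_nonneg (norm_nonneg _) (Nat.cast_nonneg _)
    · rw [hG, Set.indicator_of_notMem hmem, hF]; dsimp only
      rw [if_neg (fun h' => hmem h'.1), norm_zero]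
  have hFs : Summable fun h => ‖F h‖ :=
    Summable.of_nonneg_of_le (fun _ => norm_nonneg _) hFG hGsum.summable
  have hdef : Skeleton.kappaTilde c' D d m s = ∑' h, F h := by
    rw [Skeleton.kappaTilde]
  rw [hdef]
  calc ‖∑' h, F h‖ ≤ ∑' h, ‖F h‖ := norm_tsum_le_tsum_norm hFs
    _ ≤ ∑' h, G h := Summable.tsum_le_tsum hFG hFs hGsum.summable
    _ = Kmaj c' D d := hGsum.tsum_eq

end Literature.NumberTheory.LFunctions.Zhang2022.XiZeroMajorant
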